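import Summits.QuantumFields.YangMills.Theorems.BalabanUVNodesN15KingModelPotentialComplexLimit
import Mathlib.Analysis.Complex.Hadamard
import Mathlib.Analysis.SpecialFunctions.Trigonometric.DerivHyp

/-!
# N15 (NE2) King-model rung, PART 31 — NE2's η-RATE SURVIVES AT COMPLEX COUPLING: a two-constants theorem on the disc (from Hadamard's three lines)
# and the rate `θ^{(1−σ)k}` of the two-spacing difference `C^{(k+1)}_{z·v} − C^{(k)}_{z·v}` off the real axis

Tenth generation (g10) of the seat `pub-ymgap-dag-n15-d`, part 31 (on 28d `…PotentialComplexLimit` and Mathlib's `Complex.HadamardThreeLines`).  The NODE's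
currency is the η-RATE: the two-spacing difference of the covariances decays like `θ^k`.  Part 10e proves it for REAL dressings
(`covarianceTowerRate_fullPert`: `|C^{(k)}_v − C^{(k+1)}_v|(x,y) ≤ C·(L^{−1∕4})^k`), part 28b bounds each `C^{(k)}_z` by `2∕γ₀` at COMPLEX coupling but gives
no rate there.  Holomorphy interpolates between the two (the classical TWO-CONSTANTS theorem): if `g` is holomorphic on `ball 0 R` with `‖g‖ ≤ M`,
and `‖g t‖ ≤ ε` for REAL `t`, then off the real axis `‖g z‖ ≤ ε^{1−σ(z)}·M^{σ(z)}` with an explicit `σ(z) ∈ [0,1)` that tends to `0` at the real axis.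

* §1 GENERIC ★★ `two_constants_of_real_bound` — proved from Hadamard's three-lines theorem through the holomorphic map
  `s ↦ x₀ + ρ·tanh(−i(π∕6)s)` of the strip `0 ≤ Re s ≤ 1` into the disc (`Re s = 0 ↦` the real diameter, where `‖g‖ ≤ ε`; the whole closed strip `↦`
  the open disc, where `‖g‖ ≤ M`, because `|tanh(a − ib)|² = (sinh²a + sin²b)∕(sinh²a + cos²b) < 1` for `|b| ≤ π∕6`); the point `s = σ` lands at
  `x₀ − iρ·tan(πσ∕6)`: so for every real `x₀` and `0 < ρ < R − |x₀|`, `σ ∈ [0,1]`:  `‖g(x₀ ± iρ·tan(πσ∕6))‖ ≤ ε^{1−σ}·M^{σ}`;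
* §2 ★★★ `kingCov_twoSpacing_complexRate`: for odd `L ≥ 3`, `a, m² > 0`, every King-admissible volume, every bounded coherent potential tower `v` (10e's
  window, `w₀ > 0`), all sites and every `k ≥ 1`: at the complex couplings `z = x₀ ± i·ρ·tan(πσ∕6)` of the disc `‖z‖ < R₁ := min(r_K∕w₀, 1)`,
  `‖C^{(k+1)}_{z·v}(x,y) − C^{(k)}_{z·v}(x,y)‖ ≤ (C·θ^k)^{1−σ}·(4∕γ₀)^{σ}`, `θ = L^{−1∕4}` — NE2's rate with the exponent `(1 − σ)k` at distance `∝ tan(πσ∕6)`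
  from the real axis (the real rate `C·θ^k` of 10e and the complex bound `4∕γ₀` of 28b interpolated); ★★★ `kingCov_twoSpacing_complexRate_region`:
  for every `σ ∈ (0,1]`, the UNIFORM exponent `(1−σ)k` on the rhombus `|Re z| + |Im z|∕tan(πσ∕6) < R₁`.

References (method): Hadamard three-lines ∕ two-constants theorem (R. Nevanlinna; e.g. B. Ya. Levin, *Lectures on entire functions*, Lect. 8) [folklore];
template [B9] Thm 3.4 p.400; King (4.38) p.674.

HONEST SCOPE.  King's A = 0 SCALAR model (King-admissible tori, odd `L ≥ 3`, `a, m² > 0`); real potential towers × one complex coupling; the rate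
off the real axis is the INTERPOLATED one `θ^{(1−σ)k}` at the explicit points `x₀ ± iρ·tan(πσ∕6)` (these cover the sub-region
`|Im z| < (R₁ − |Re z|)·tan(π∕6)` of the disc; no uniform-in-`z` exponent is claimed); no decay in `|x − y|` off the real axis; NOT Bałaban's `U′U`; NOT a node discharge; count-neutral.  No `sorry`.
-/

noncomputable section

open scoped BigOperators Matrix
open Filter Topology Metric Finset Complex

namespace Summit.QuantumFields.YangMills.BalabanUVNodes.N15.KingModel

open Literature.MathematicalPhysics.QuantumFieldTheory.Balaban1983to89 hiding blockOf
open Literature.MathematicalPhysics.QuantumFieldTheory.Balaban1983to89.B5Prop11Plancherel (Tor fine)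
open Literature.MathematicalPhysics.QuantumFieldTheory.King1986.Torus (gam0L gam0L_pos tdistT)
open Summit.QuantumFields.BalabanUV.T4Continuum.NE2KingTransplant (IsPseudoMetric)
open Summit.QuantumFields.YangMills.BalabanUVNodes.N15KingModelRung.Curved (underPtN)
open Summit.QuantumFields.BalabanUV.T4Continuum.NE2KingTransplant (CovarianceTowerRate)

variable {d : ℕ}

/-! ## §1 A two-constants theorem on the disc from Hadamard's three lines -/

section TwoConstants

/-- `cosh(a + bi) = cosh a·cos b + i·sinh a·sin b`. [folklore] -/
theorem cosh_ofReal_add_mul_I (a b : ℝ) :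
    Complex.cosh ((a : ℂ) + (b : ℂ) * I) = ((Real.cosh a * Real.cos b : ℝ) : ℂ) + ((Real.sinh a * Real.sin b : ℝ) : ℂ) * I := by
  rw [Complex.cosh_add, Complex.cosh_mul_I, Complex.sinh_mul_I]
  push_cast
  ring

/-- `sinh(a + bi) = sinh a·cos b + i·cosh a·sin b`. [folklore] -/
theorem sinh_ofReal_add_mul_I (a b : ℝ) :
    Complex.sinh ((a : ℂ) + (b : ℂ) * I) = ((Real.sinh a * Real.cos b : ℝ) : ℂ) + ((Real.cosh a * Real.sin b : ℝ) : ℂ) * I := by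
  rw [Complex.sinh_add, Complex.cosh_mul_I, Complex.sinh_mul_I]
  push_cast
  ring

/-- `|cosh(a + bi)|² = sinh²a + cos²b`. [folklore] -/
theorem normSq_cosh_ofReal_add_mul_I (a b : ℝ) : Complex.normSq (Complex.cosh ((a : ℂ) + (b : ℂ) * I)) = Real.sinh a ^ 2 + Real.cos b ^ 2 := by
  rw [cosh_ofReal_add_mul_I, Complex.normSq_add_mul_I]
  have h1 := Real.cosh_sq a
  have h2 := Real.cos_sq_add_sin_sq b
  nlinarith [h1, h2]

/-- `|sinh(a + bi)|² = sinh²a + sin²b`. [folklore] -/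
theorem normSq_sinh_ofReal_add_mul_I (a b : ℝ) : Complex.normSq (Complex.sinh ((a : ℂ) + (b : ℂ) * I)) = Real.sinh a ^ 2 + Real.sin b ^ 2 := by
  rw [sinh_ofReal_add_mul_I, Complex.normSq_add_mul_I]
  have h1 := Real.cosh_sq a
  have h2 := Real.cos_sq_add_sin_sq b
  nlinarith [h1, h2]

/-- For `|b| ≤ π∕6`: `sin²b ≤ 1∕4` and `3∕4 ≤ cos²b`. [folklore] -/
theorem sin_sq_le_cos_sq_bounds {b : ℝ} (hb : |b| ≤ Real.pi / 6) : Real.sin b ^ 2 ≤ 1 / 4 ∧ 3 / 4 ≤ Real.cos b ^ 2 := by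
  have hpi := Real.pi_pos
  have hb1 : -(Real.pi / 2) ≤ |b| := by linarith [abs_nonneg b]
  have hs : Real.sin |b| ≤ 1 / 2 := by
    rw [← Real.sin_pi_div_six]
    exact Real.sin_le_sin_of_le_of_le_pi_div_two hb1 (by linarith) hb
  have hs0 : 0 ≤ Real.sin |b| := Real.sin_nonneg_of_nonneg_of_le_pi (abs_nonneg b) (by linarith)
  have hsq : Real.sin b ^ 2 = Real.sin |b| ^ 2 := by
    rcases abs_choice b with h | h
    · rw [h]
    · rw [h, Real.sin_neg, neg_sq]
  have h1 : Real.sin b ^ 2 ≤ 1 / 4 := by rw [hsq]; nlinarith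
  refine ⟨h1, ?_⟩
  have h2 := Real.cos_sq_add_sin_sq b
  linarith

/-- The strip-to-disc map: `|tanh(a − bi)| < 1` for `|b| ≤ π∕6` (indeed `|tanh|² = (sinh²a + sin²b)∕(sinh²a + cos²b)`), and `cosh(a − bi) ≠ 0`. [folklore] -/
theorem norm_tanh_lt_one {a b : ℝ} (hb : |b| ≤ Real.pi / 6) :
    Complex.cosh ((a : ℂ) + (b : ℂ) * I) ≠ 0 ∧ ‖Complex.tanh ((a : ℂ) + (b : ℂ) * I)‖ < 1 := by
  obtain ⟨hs, hc⟩ := sin_sq_le_cos_sq_bounds hb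
  have hC : Complex.normSq (Complex.cosh ((a : ℂ) + (b : ℂ) * I)) = Real.sinh a ^ 2 + Real.cos b ^ 2 := normSq_cosh_ofReal_add_mul_I a b
  have hS : Complex.normSq (Complex.sinh ((a : ℂ) + (b : ℂ) * I)) = Real.sinh a ^ 2 + Real.sin b ^ 2 := normSq_sinh_ofReal_add_mul_I a b
  have hCpos : 0 < Real.sinh a ^ 2 + Real.cos b ^ 2 := by nlinarith [sq_nonneg (Real.sinh a)]
  have hne : Complex.cosh ((a : ℂ) + (b : ℂ) * I) ≠ 0 := by
    intro h0
    rw [h0, map_zero] at hC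
    linarith
  refine ⟨hne, ?_⟩
  rw [Complex.tanh_eq_sinh_div_cosh, norm_div]
  rw [div_lt_one (norm_pos_iff.mpr hne)]
  have h1 : ‖Complex.sinh ((a : ℂ) + (b : ℂ) * I)‖ ^ 2 < ‖Complex.cosh ((a : ℂ) + (b : ℂ) * I)‖ ^ 2 := by
    rw [Complex.sq_norm, Complex.sq_norm, hS, hC]
    linarith
  exact lt_of_pow_lt_pow_left₀ 2 (norm_nonneg _) h1

/-- The strip parameter as `a + bi` with `a = (π∕6)·Im s`, `b = −(π∕6)·Re s`: `−i(π∕6)s = a + bi`. [folklore] -/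
theorem neg_I_mul_eq (c : ℝ) (s : ℂ) : -(I * (c : ℂ)) * s = ((c * s.im : ℝ) : ℂ) + ((-(c * s.re) : ℝ) : ℂ) * I := by
  apply Complex.ext <;> simp

/-- ★★ **TWO-CONSTANTS THEOREM ON THE DISC (real-axis version)**: let `g` be holomorphic on `ball 0 R` with `‖g z‖ ≤ M` there and `‖g t‖ ≤ ε` for all real
`t` with `|t| < R`.  Then for every real `x₀`, every `0 < ρ < R − |x₀|` and every `σ ∈ [0,1]`:
`‖g(x₀ − i·ρ·tan(πσ∕6))‖ ≤ ε^{1−σ}·M^{σ}` — from Hadamard's three-lines theorem for `s ↦ g(x₀ + ρ·tanh(−i(π∕6)s))` on the strip `0 ≤ Re s ≤ 1`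
(`Re s = 0 ↦` the real diameter, the closed strip `↦` the open disc since `|tanh(a − ib)| < 1` for `|b| ≤ π∕6`). [folklore] -/
theorem two_constants_of_real_bound {g : ℂ → ℂ} {R M ε : ℝ} (hg : DifferentiableOn ℂ g (ball 0 R)) (hM : ∀ z ∈ ball (0 : ℂ) R, ‖g z‖ ≤ M)
    (hε : ∀ t : ℝ, |t| < R → ‖g (t : ℂ)‖ ≤ ε) {x₀ ρ : ℝ} (hρ : 0 < ρ) (hρR : |x₀| + ρ < R) {σ : ℝ} (hσ0 : 0 ≤ σ) (hσ1 : σ ≤ 1) :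
    ‖g ((x₀ : ℂ) - I * (ρ * Real.tan (Real.pi / 6 * σ) : ℝ))‖ ≤ ε ^ (1 - σ) * M ^ σ := by
  have hpi := Real.pi_pos
  set c : ℝ := Real.pi / 6 with hc
  -- the map ψ and the composed function F on the strip
  set ψ : ℂ → ℂ := fun s => (x₀ : ℂ) + (ρ : ℂ) * Complex.tanh (-(I * (c : ℂ)) * s) with hψ
  set F : ℂ → ℂ := fun s => g (ψ s) with hF
  -- on the closed strip the map lands in the ball, and `cosh ≠ 0`
  have hstrip : ∀ s : ℂ, s ∈ HadamardThreeLines.verticalClosedStrip 0 1 →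
      Complex.cosh (-(I * (c : ℂ)) * s) ≠ 0 ∧ ‖Complex.tanh (-(I * (c : ℂ)) * s)‖ < 1 := by
    intro s hs
    have hre : 0 ≤ s.re ∧ s.re ≤ 1 := by simpa [HadamardThreeLines.verticalClosedStrip] using hs
    have hb : |(-(c * s.re))| ≤ Real.pi / 6 := by
      have hc0 : 0 ≤ c := by rw [hc]; positivity
      rw [abs_neg, abs_of_nonneg (mul_nonneg hc0 hre.1), hc]
      nlinarith
    rw [neg_I_mul_eq]
    exact norm_tanh_lt_one hb
  have hball : ∀ s : ℂ, s ∈ HadamardThreeLines.verticalClosedStrip 0 1 → ψ s ∈ ball (0 : ℂ) R := by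
    intro s hs
    have h1 := (hstrip s hs).2
    rw [mem_ball_zero_iff, hψ]
    calc ‖(x₀ : ℂ) + (ρ : ℂ) * Complex.tanh (-(I * (c : ℂ)) * s)‖ ≤ ‖(x₀ : ℂ)‖ + ‖(ρ : ℂ) * Complex.tanh (-(I * (c : ℂ)) * s)‖ := norm_add_le _ _
      _ < |x₀| + ρ := by
          rw [Complex.norm_real, Real.norm_eq_abs, norm_mul, Complex.norm_real, Real.norm_eq_abs, abs_of_pos hρ]
          have : ρ * ‖Complex.tanh (-(I * (c : ℂ)) * s)‖ < ρ * 1 := mul_lt_mul_of_pos_left h1 hρ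
          linarith
      _ < R := hρR
  -- ψ is differentiable at every point of the closed strip
  have hψd : ∀ s : ℂ, s ∈ HadamardThreeLines.verticalClosedStrip 0 1 → DifferentiableAt ℂ ψ s := by
    intro s hs
    have hne := (hstrip s hs).1
    have hlin : DifferentiableAt ℂ (fun s : ℂ => -(I * (c : ℂ)) * s) s := (differentiableAt_id).const_mul _
    have htanh : DifferentiableAt ℂ (fun s : ℂ => Complex.tanh (-(I * (c : ℂ)) * s)) s := by
      have h1 : DifferentiableAt ℂ (fun s : ℂ => Complex.sinh (-(I * (c : ℂ)) * s) / Complex.cosh (-(I * (c : ℂ)) * s)) s :=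
        ((Complex.differentiable_sinh.differentiableAt).comp s hlin).div ((Complex.differentiable_cosh.differentiableAt).comp s hlin) hne
      refine h1.congr_of_eventuallyEq (Filter.Eventually.of_forall fun s' => ?_)
      exact Complex.tanh_eq_sinh_div_cosh _
    exact (differentiableAt_const _).add ((differentiableAt_const _).mul htanh)
  -- F is differentiable on the closed strip, hence `DiffContOnCl` on the open strip
  have hFd : DifferentiableOn ℂ F (HadamardThreeLines.verticalClosedStrip 0 1) := fun s hs =>
    ((hg.differentiableAt (isOpen_ball.mem_nhds (hball s hs))).comp s (hψd s hs)).differentiableWithinAt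
  have hclos : closure (HadamardThreeLines.verticalStrip 0 1) = HadamardThreeLines.verticalClosedStrip 0 1 := by
    rw [HadamardThreeLines.verticalStrip, HadamardThreeLines.verticalClosedStrip, ← closure_Ioo zero_ne_one, closure_preimage_re]
  have hDC : DiffContOnCl ℂ F (HadamardThreeLines.verticalStrip 0 1) := by
    refine DifferentiableOn.diffContOnCl ?_
    rw [hclos]
    exact hFd
  -- bounds
  have hB : BddAbove ((norm ∘ F) '' HadamardThreeLines.verticalClosedStrip 0 1) := by
    refine ⟨M, ?_⟩
    rintro _ ⟨s, hs, rfl⟩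
    exact hM _ (hball s hs)
  have h0 : ∀ s ∈ re ⁻¹' ({0} : Set ℝ), ‖F s‖ ≤ ε := by
    intro s hs
    have hre : s.re = 0 := by simpa using hs
    -- ψ s is real, of modulus < R
    have hs' : s ∈ HadamardThreeLines.verticalClosedStrip 0 1 := by
      simp [HadamardThreeLines.verticalClosedStrip, hre]
    have hreal : ψ s = ((x₀ + ρ * Real.tanh (c * s.im) : ℝ) : ℂ) := by
      rw [hψ]
      show (x₀ : ℂ) + (ρ : ℂ) * Complex.tanh (-(I * (c : ℂ)) * s) = _
      rw [neg_I_mul_eq, hre, mul_zero, neg_zero, Complex.ofReal_zero, zero_mul, add_zero, ← Complex.ofReal_tanh]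
      push_cast
      ring
    have hlt : |x₀ + ρ * Real.tanh (c * s.im)| < R := by
      have hb := hball s hs'
      rw [mem_ball_zero_iff, hreal, Complex.norm_real, Real.norm_eq_abs] at hb
      exact hb
    show ‖g (ψ s)‖ ≤ ε
    rw [hreal]
    exact hε _ hlt
  have h1 : ∀ s ∈ re ⁻¹' ({1} : Set ℝ), ‖F s‖ ≤ M := by
    intro s hs
    have hre : s.re = 1 := by simpa using hs
    have hs' : s ∈ HadamardThreeLines.verticalClosedStrip 0 1 := by
      simp [HadamardThreeLines.verticalClosedStrip, hre]
    exact hM _ (hball s hs')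
  -- Hadamard at the real point σ of the strip
  have hσ : ((σ : ℝ) : ℂ) ∈ HadamardThreeLines.verticalClosedStrip 0 1 := by
    simp [HadamardThreeLines.verticalClosedStrip, hσ0, hσ1]
  have key := HadamardThreeLines.norm_le_interp_of_mem_verticalClosedStrip₀₁' F hσ hDC hB h0 h1
  -- the point: ψ σ = x₀ − iρ tan(cσ)
  have hpt : ψ (σ : ℂ) = (x₀ : ℂ) - I * (ρ * Real.tan (c * σ) : ℝ) := by
    rw [hψ]
    show (x₀ : ℂ) + (ρ : ℂ) * Complex.tanh (-(I * (c : ℂ)) * (σ : ℂ)) = _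
    have e1 : -(I * (c : ℂ)) * (σ : ℂ) = -(((c * σ : ℝ) : ℂ) * I) := by push_cast; ring
    rw [e1, Complex.tanh_neg, Complex.tanh_mul_I, ← Complex.ofReal_tan]
    push_cast
    ring
  have key' : ‖F (σ : ℂ)‖ ≤ ε ^ (1 - σ) * M ^ σ := by simpa [Complex.ofReal_re] using key
  rw [hF] at key'
  simpa only [hpt] using key'

/-- **The mirror point** `x₀ + iρ·tan(πσ∕6)` (apply the theorem to `z ↦ g(conj-free reflection) = g(−z)` after `x₀ ↦ −x₀`). [folklore] -/
theorem two_constants_of_real_bound' {g : ℂ → ℂ} {R M ε : ℝ} (hg : DifferentiableOn ℂ g (ball 0 R)) (hM : ∀ z ∈ ball (0 : ℂ) R, ‖g z‖ ≤ M)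
    (hε : ∀ t : ℝ, |t| < R → ‖g (t : ℂ)‖ ≤ ε) {x₀ ρ : ℝ} (hρ : 0 < ρ) (hρR : |x₀| + ρ < R) {σ : ℝ} (hσ0 : 0 ≤ σ) (hσ1 : σ ≤ 1) :
    ‖g ((x₀ : ℂ) + I * (ρ * Real.tan (Real.pi / 6 * σ) : ℝ))‖ ≤ ε ^ (1 - σ) * M ^ σ := by
  -- g⁻(z) := g(−z) has the same bounds; its point −x₀ − iρ tan is minus ours
  have hneg : ∀ z : ℂ, z ∈ ball (0 : ℂ) R → -z ∈ ball (0 : ℂ) R := fun z hz => by simpa [mem_ball_zero_iff] using hz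
  have hg' : DifferentiableOn ℂ (fun z => g (-z)) (ball 0 R) := fun z hz =>
    ((hg.differentiableAt (isOpen_ball.mem_nhds (hneg z hz))).comp z differentiableAt_id.neg).differentiableWithinAt
  have hM' : ∀ z ∈ ball (0 : ℂ) R, ‖g (-z)‖ ≤ M := fun z hz => hM _ (hneg z hz)
  have hε' : ∀ t : ℝ, |t| < R → ‖g (-(t : ℂ))‖ ≤ ε := fun t ht => by
    have := hε (-t) (by rwa [abs_neg])
    simpa using this
  have hρR' : |(-x₀)| + ρ < R := by rwa [abs_neg]
  have h : ‖g (-(((-x₀ : ℝ) : ℂ) - I * ((ρ * Real.tan (Real.pi / 6 * σ) : ℝ) : ℂ)))‖ ≤ ε ^ (1 - σ) * M ^ σ :=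
    two_constants_of_real_bound hg' hM' hε' hρ hρR' hσ0 hσ1
  have e : -(((-x₀ : ℝ) : ℂ) - I * ((ρ * Real.tan (Real.pi / 6 * σ) : ℝ) : ℂ)) = (x₀ : ℂ) + I * ((ρ * Real.tan (Real.pi / 6 * σ) : ℝ) : ℂ) := by
    push_cast; ring
  rwa [e] at h

end TwoConstants

/-! ## §2 NE2's rate at complex coupling -/

section Rate

variable (L : ℕ) [NeZero L]

/-- ★★★ **NE2's η-RATE SURVIVES AT COMPLEX COUPLING, WITH THE INTERPOLATED EXPONENT.**  For odd `L ≥ 3`, `a, m² > 0` there are `w₁, C > 0` such that for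
every volume exponent `e`, every potential tower `v` with `sup|v_N| ≤ w₀ ≤ w₁`, `w₀ > 0`, coherence defect `≤ ν₀s^k` (`0 ≤ ν₀ ≤ w₁`, `0 ≤ s ≤ L^{−1∕2}`), all
unit sites `x, y`, every `k ≥ 1`, and — with `R₁ := min(r_K∕w₀, 1)` — every real `x₀`, `0 < ρ < R₁ − |x₀|`, `σ ∈ [0,1]`, at both couplings
`z = x₀ ± i·ρ·tan(πσ∕6)`:
`‖C^{(k+1)}_{z·v}(x,y) − C^{(k)}_{z·v}(x,y)‖ ≤ (C·θ^k)^{1−σ}·(4∕γ₀)^{σ}`, `θ = L^{−1∕4}`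
(10e's real rate `covarianceTowerRate_fullPert` on the diameter, 28b's bound `2∕γ₀ + 2∕γ₀` on the disc, §1's two-constants theorem).
[cite: King1986, Lemma 4.5 (4.38) p.674 (A = 0 template); Balaban1985BackgroundPropagators, Thm 3.4 p.400 (template)] -/
theorem kingCov_twoSpacing_complexRate (hLodd : Odd L) (hL : 2 ≤ L) {a m2 : ℝ} (ha : 0 < a) (hm : 0 < m2) :
    ∃ w₁ C : ℝ, 0 < w₁ ∧ 0 < C ∧
      ∀ (e : ℕ) (v : ∀ N : ℕ, Tor (fine N (kingU d L e)) → ℝ) (w₀ ν₀ s : ℝ),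
      0 ≤ ν₀ → ν₀ ≤ w₁ → 0 ≤ s → s ≤ (L : ℝ) ^ (-(1 / 2 : ℝ)) →
      0 < w₀ → (∀ (N : ℕ) (x : Tor (fine N (kingU d L e))), |v N x| ≤ w₀) → w₀ ≤ w₁ →
      (∀ (k : ℕ), 1 ≤ k → ∀ x' : Tor (fine (L ^ 1 * L ^ k) (kingU d L e)),
          |v (L ^ 1 * L ^ k) x' - v (L ^ k) (underPtN L k 1 (kingU d L e) x')| ≤ ν₀ * s ^ k) →
      ∀ (x y : Tor (kingU d L e)) (k : ℕ), 1 ≤ k →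
      ∀ (x₀ ρ σ : ℝ), 0 < ρ → |x₀| + ρ < min (cplxWindow d a m2 L / w₀) 1 → 0 ≤ σ → σ ≤ 1 →
        ‖kingCovPotC d a m2 L (kingM d L e) (k + 1) ((x₀ : ℂ) - I * (ρ * Real.tan (Real.pi / 6 * σ) : ℝ)) (v (L ^ (k + 1))) x y
            - kingCovPotC d a m2 L (kingM d L e) k ((x₀ : ℂ) - I * (ρ * Real.tan (Real.pi / 6 * σ) : ℝ)) (v (L ^ k)) x y‖
          ≤ (C * (((L : ℝ) ^ (-(1 / 4 : ℝ))) ^ k)) ^ (1 - σ) * (4 / gam0L (d + 1) a L) ^ σ ∧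
        ‖kingCovPotC d a m2 L (kingM d L e) (k + 1) ((x₀ : ℂ) + I * (ρ * Real.tan (Real.pi / 6 * σ) : ℝ)) (v (L ^ (k + 1))) x y
            - kingCovPotC d a m2 L (kingM d L e) k ((x₀ : ℂ) + I * (ρ * Real.tan (Real.pi / 6 * σ) : ℝ)) (v (L ^ k)) x y‖
          ≤ (C * (((L : ℝ) ^ (-(1 / 4 : ℝ))) ^ k)) ^ (1 - σ) * (4 / gam0L (d + 1) a L) ^ σ := by
  obtain ⟨κ, w₁, C, hκ, hw₁, hC, H⟩ := covarianceTowerRate_fullPert (d := d) L hLodd hL ha hm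
  refine ⟨w₁, C, hw₁, hC, ?_⟩
  intro e v w₀ ν₀ s hν₀ hν₁ hs0 hs1 hw₀ hv hw₁' hcoh x y k hk x₀ ρ σ hρ hρR hσ0 hσ1
  have hγ := gam0L_pos (d := d + 1) ha hL
  set θ : ℝ := (L : ℝ) ^ (-(1 / 4 : ℝ)) with hθ
  set R₁ : ℝ := min (cplxWindow d a m2 L / w₀) 1 with hR₁
  -- the two-spacing difference as a function of the complex coupling
  set g : ℂ → ℂ := fun z => kingCovPotC d a m2 L (kingM d L e) (k + 1) z (v (L ^ (k + 1))) x y - kingCovPotC d a m2 L (kingM d L e) k z (v (L ^ k)) x y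
    with hg
  have hzw : ∀ z ∈ ball (0 : ℂ) R₁, ‖z‖ * w₀ ≤ cplxWindow d a m2 L := by
    intro z hz
    rw [mem_ball_zero_iff] at hz
    have hz' : ‖z‖ < cplxWindow d a m2 L / w₀ := lt_of_lt_of_le hz (min_le_left _ _)
    have : ‖z‖ * w₀ < cplxWindow d a m2 L / w₀ * w₀ := mul_lt_mul_of_pos_right hz' hw₀
    rw [div_mul_cancel₀ _ hw₀.ne'] at this
    exact this.le
  have hk1 : 1 ≤ k + 1 := Nat.succ_le_succ (Nat.zero_le k)
  -- holomorphy and the bound 4/γ₀ on the disc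
  have hgd : DifferentiableOn ℂ g (ball 0 R₁) := fun z hz =>
    ((differentiableAt_kingCovPotC_apply (M := kingM d L e) ha hm hL hk1 hw₀.le (hv _) (hzw z hz) x y).sub
      (differentiableAt_kingCovPotC_apply (M := kingM d L e) ha hm hL hk hw₀.le (hv _) (hzw z hz) x y)).differentiableWithinAt
  have hgM : ∀ z ∈ ball (0 : ℂ) R₁, ‖g z‖ ≤ 4 / gam0L (d + 1) a L := by
    intro z hz
    calc ‖g z‖ ≤ ‖kingCovPotC d a m2 L (kingM d L e) (k + 1) z (v (L ^ (k + 1))) x y‖ + ‖kingCovPotC d a m2 L (kingM d L e) k z (v (L ^ k)) x y‖ :=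
          norm_sub_le _ _
      _ ≤ 2 / gam0L (d + 1) a L + 2 / gam0L (d + 1) a L :=
          add_le_add (kingCovPotC_apply_norm_le ha hm hL hk1 hw₀.le (hv _) (hzw z hz) x y)
            (kingCovPotC_apply_norm_le ha hm hL hk hw₀.le (hv _) (hzw z hz) x y)
      _ = 4 / gam0L (d + 1) a L := by ring
  -- the real rate on the diameter (10e on the tower t·v, |t| < 1)
  have hgε : ∀ t : ℝ, |t| < R₁ → ‖g (t : ℂ)‖ ≤ C * θ ^ k := by
    intro t ht
    have ht1 : |t| < 1 := lt_of_lt_of_le ht (min_le_right _ _)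
    have hvt : ∀ (N : ℕ) (x : Tor (fine N (kingU d L e))), |(t • v) N x| ≤ |t| * w₀ := by
      intro N x'
      show |t * v N x'| ≤ |t| * w₀
      rw [abs_mul]
      exact mul_le_mul_of_nonneg_left (hv N x') (abs_nonneg t)
    have hcoht : ∀ (k : ℕ), 1 ≤ k → ∀ x' : Tor (fine (L ^ 1 * L ^ k) (kingU d L e)),
        |(t • v) (L ^ 1 * L ^ k) x' - (t • v) (L ^ k) (underPtN L k 1 (kingU d L e) x')| ≤ (|t| * ν₀) * s ^ k := by
      intro k hk x'
      show |t * v (L ^ 1 * L ^ k) x' - t * v (L ^ k) (underPtN L k 1 (kingU d L e) x')| ≤ (|t| * ν₀) * s ^ k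
      rw [← mul_sub, abs_mul, mul_assoc]
      exact mul_le_mul_of_nonneg_left (hcoh k hk x') (abs_nonneg t)
    have htw : |t| * w₀ ≤ w₁ := by nlinarith [abs_nonneg t]
    have htν : |t| * ν₀ ≤ w₁ := by nlinarith [abs_nonneg t]
    obtain ⟨hrate, -⟩ := H e (t • v) (|t| * w₀) (|t| * ν₀) s (by positivity) htν hs0 hs1 hvt htw hcoht
    have hr : |kingCovE a m2 L (kingM d L e) (fullPert a m2 L (kingM d L e) (t • v)) k x y
        - kingCovE a m2 L (kingM d L e) (fullPert a m2 L (kingM d L e) (t • v)) (k + 1) x y|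
        ≤ C * θ ^ k * Real.exp (-(κ / 2 * tdistT (kingU d L e) x y)) := hrate k x y
    -- read both covariances over ℂ at the real coupling
    have e1 : g (t : ℂ) = (((kingCovE a m2 L (kingM d L e) (fullPert a m2 L (kingM d L e) (t • v)) (k + 1) x y
        - kingCovE a m2 L (kingM d L e) (fullPert a m2 L (kingM d L e) (t • v)) k x y : ℝ)) : ℂ) := by
      rw [hg]
      show kingCovPotC d a m2 L (kingM d L e) (k + 1) (t : ℂ) (v (L ^ (k + 1))) x y - kingCovPotC d a m2 L (kingM d L e) k (t : ℂ) (v (L ^ k)) x y = _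
      rw [kingCovPotC_real_eq_kingCovE v hk1 t x y, kingCovPotC_real_eq_kingCovE v hk t x y]
      push_cast
      ring
    rw [e1, Complex.norm_real, Real.norm_eq_abs, abs_sub_comm]
    have hexp : Real.exp (-(κ / 2 * tdistT (kingU d L e) x y)) ≤ 1 := by
      rw [Real.exp_le_one_iff]
      have := (isPseudoMetric_tdistT (kingU d L e)).nonneg x y
      nlinarith
    have hCθ : 0 ≤ C * θ ^ k := by positivity
    calc |kingCovE a m2 L (kingM d L e) (fullPert a m2 L (kingM d L e) (t • v)) k x y
          - kingCovE a m2 L (kingM d L e) (fullPert a m2 L (kingM d L e) (t • v)) (k + 1) x y|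
        ≤ C * θ ^ k * Real.exp (-(κ / 2 * tdistT (kingU d L e) x y)) := hr
      _ ≤ C * θ ^ k * 1 := mul_le_mul_of_nonneg_left hexp hCθ
      _ = C * θ ^ k := mul_one _
  exact ⟨two_constants_of_real_bound hgd hgM hgε hρ hρR hσ0 hσ1, two_constants_of_real_bound' hgd hgM hgε hρ hρR hσ0 hσ1⟩

/-- ★★★ **THE SAME, POINT BY POINT: a UNIFORM exponent on an explicit region.**  With the data of `kingCov_twoSpacing_complexRate` and any `σ ∈ (0,1]`, for EVERY
complex coupling `z` with `z.im ≠ 0` in the rhombus `|Re z| + |Im z|∕tan(πσ∕6) < min(r_K∕w₀, 1)`: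
`‖C^{(k+1)}_{z·v}(x,y) − C^{(k)}_{z·v}(x,y)‖ ≤ (C·θ^k)^{1−σ}·(4∕γ₀)^{σ}` — the η-rate with the uniform exponent `(1−σ)k` on that region (take `ρ = |Im z|∕tan(πσ∕6)`
in the previous theorem; on the real axis itself 10e gives `C·θ^k`). [cite: King1986, Lemma 4.5 (4.38) p.674 (A = 0 template)] -/
theorem kingCov_twoSpacing_complexRate_region (hLodd : Odd L) (hL : 2 ≤ L) {a m2 : ℝ} (ha : 0 < a) (hm : 0 < m2) :
    ∃ w₁ C : ℝ, 0 < w₁ ∧ 0 < C ∧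
      ∀ (e : ℕ) (v : ∀ N : ℕ, Tor (fine N (kingU d L e)) → ℝ) (w₀ ν₀ s : ℝ),
      0 ≤ ν₀ → ν₀ ≤ w₁ → 0 ≤ s → s ≤ (L : ℝ) ^ (-(1 / 2 : ℝ)) →
      0 < w₀ → (∀ (N : ℕ) (x : Tor (fine N (kingU d L e))), |v N x| ≤ w₀) → w₀ ≤ w₁ →
      (∀ (k : ℕ), 1 ≤ k → ∀ x' : Tor (fine (L ^ 1 * L ^ k) (kingU d L e)),
          |v (L ^ 1 * L ^ k) x' - v (L ^ k) (underPtN L k 1 (kingU d L e) x')| ≤ ν₀ * s ^ k) →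
      ∀ (x y : Tor (kingU d L e)) (k : ℕ), 1 ≤ k →
      ∀ (σ : ℝ), 0 < σ → σ ≤ 1 → ∀ z : ℂ, z.im ≠ 0 →
        |z.re| + |z.im| / Real.tan (Real.pi / 6 * σ) < min (cplxWindow d a m2 L / w₀) 1 →
        ‖kingCovPotC d a m2 L (kingM d L e) (k + 1) z (v (L ^ (k + 1))) x y - kingCovPotC d a m2 L (kingM d L e) k z (v (L ^ k)) x y‖
          ≤ (C * (((L : ℝ) ^ (-(1 / 4 : ℝ))) ^ k)) ^ (1 - σ) * (4 / gam0L (d + 1) a L) ^ σ := by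
  obtain ⟨w₁, C, hw₁, hC, H⟩ := kingCov_twoSpacing_complexRate (d := d) L hLodd hL ha hm
  refine ⟨w₁, C, hw₁, hC, ?_⟩
  intro e v w₀ ν₀ s hν₀ hν₁ hs0 hs1 hw₀ hv hw₁' hcoh x y k hk σ hσ0 hσ1 z hzim hz
  have hpi := Real.pi_pos
  have htan : 0 < Real.tan (Real.pi / 6 * σ) := by
    apply Real.tan_pos_of_pos_of_lt_pi_div_two (by positivity)
    nlinarith
  set ρ : ℝ := |z.im| / Real.tan (Real.pi / 6 * σ) with hρdef
  have hρ : 0 < ρ := div_pos (abs_pos.mpr hzim) htan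
  have hρt : ρ * Real.tan (Real.pi / 6 * σ) = |z.im| := div_mul_cancel₀ _ htan.ne'
  have hmain := H e v w₀ ν₀ s hν₀ hν₁ hs0 hs1 hw₀ hv hw₁' hcoh x y k hk z.re ρ σ hρ hz hσ0.le hσ1
  rcases lt_or_gt_of_ne hzim with hneg | hpos
  · -- z.im < 0: z = re − i|im|
    have hz' : (z.re : ℂ) - I * ((ρ * Real.tan (Real.pi / 6 * σ) : ℝ) : ℂ) = z := by
      rw [hρt, abs_of_neg hneg]
      conv_rhs => rw [← Complex.re_add_im z]
      push_cast
      ring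
    have h := hmain.1
    rwa [hz'] at h
  · have hz' : (z.re : ℂ) + I * ((ρ * Real.tan (Real.pi / 6 * σ) : ℝ) : ℂ) = z := by
      rw [hρt, abs_of_pos hpos]
      conv_rhs => rw [← Complex.re_add_im z]
      ring
    have h := hmain.2
    rwa [hz'] at h

end Rate

end Summit.QuantumFields.YangMills.BalabanUVNodes.N15.KingModel

end
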